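import Mathlib
import HarnessLib
import HarnessLib.Audit
import Summits.QuantumAdvantage.Statement
import Literature.Computability.QuantumComplexity.PauliExpansion
import Literature.Computability.Complexity.CircuitClasses
import HarnessLib.Audit.Status.Attr

/-!
Route: SpinorFlattening

CLOSED (refuted) 2026-08-16T04:23:28Z by planner-rfix-QuantumAdvantage-SpinorFlatteni-1f11c3df-0 — reason: refuted:stmt-QuantumAdvantage-1244 (GaussRankPolyThesis) by Summit.QuantumAdvantage.QuantumAdvantage.Theorems.SpinorFlatteningGaussRankPolyThesis_refuted — note: Summit.QuantumAdvantage.QuantumAdvantage.Theorems.SpinorFlatteningGaussRankPolyThesis_refuted @1fc1f4666c4c; SUBSTANTIVE = the route's designed kill (KILL CRITERIA r2): kill item NegApproxGaussRankSuperpoly (1245) PROVED (SpinorFlattening.NegApproxGaussRankSuperpoly_of: Bessel mass bound + CAR norma. The file is kept as the record of this route; refuted decls are indexed as negative knowledge (`ledger negatives`).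

# Route QuantumAdvantage/SpinorFlattening — NEGATION side on the free-fermion island: BQP ⊆ BPP by
matchgate (fermionic-linear-optics) + magic-state Gaussian-RANK simulation; kill items =
Clifford-algebra FLATTENING lower bounds on the spinor variety (realises idea card
spinor-flattening-gaussian-rank)

## Thesis X (targets ¬Statement, i.e. BQP ⊆ BPP)
Words: the matchgate magic state |M⟩ = (|0000⟩+|1111⟩)/√2 has POLYNOMIAL δ-approximate fermionic
Gaussian rank: for every δ > 0 there is c with χ^G_δ(|M⟩^{⊗t}) ≤ t^c + c for all t (decl
`GaussRankPolyThesis`).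
Lean (self-contained over `Literature.Computability.QuantumComplexity.pauliString`,
`Literature.Computability.Cryptography.QReg/normSq`; three shared `let`s): maj n j b = Jordan–Wigner
Majorana Z^{<j}(X|Y)_j; IsGauss n ψ := ψ ≠ 0 ∧ ∃ A : Fin n → (Fin n × Bool → ℂ), LinearIndependent ℂ
A ∧ ∀ k, (Σ_p A k p • maj n p.1 p.2) *ᵥ ψ = 0 (pure spinor = Fock vacuum; both parities; = the
dictionary 𝒢_n of DiasKoenig2024 §2.3 / CudbyStrelchuk2023; Bravyi2005); Mpow t = |M⟩^{⊗t} on t*4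
qubits (amplitude (√2)^{-t} on block-constant strings). X := ∀ δ > 0, ∃ c, ∀ t, ∃ r ≤ t^c + c, ∃ (a
: Fin r → ℂ) (g : Fin r → QReg (t*4) → ℂ), (∀ i, IsGauss (t*4) (g i)) ∧ normSq (Mpow t − Σ i, a i •
g i) ≤ δ^2.

## Deciding theorem (refutation side) and Assembly
`closes (h₁ : GaussRankPolyCollapse) (h₂ : GaussRankPolyThesis) : ¬ QuantumAdvantage` —
gate-certified (authority native, rev 4): ¬∃ L ∈ BQP ∖ BPP in two lines (`rintro ⟨L, hL, hLn⟩; exact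
hLn (h₁ h₂ hL)`). GaussRankPolyCollapse := `GaussRankPolyThesis → BQP ⊆ BPP` (support,
stmt-QuantumAdvantage-10445) is the typed collapse antecedent; the Assembly item
`(GaussRankPolyThesis → BQP ⊆ BPP) → GaussRankPolyThesis → ¬ QuantumAdvantage` is the same wiring
with the antecedent inline (definitionally equal; settled-trivial, candidate proofs attached as
evidence). The kill item NegApproxGaussRankSuperpoly is deliberately NOT an antecedent of `closes`
(target + kill would certify ex falso). HONEST STATUS of the antecedent: as typed (non-uniform
existence hypothesis ⇒ uniform conclusion) it is provable only ex falso once the kill item lands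
(the expected outcome: target refuted → route BROKEN → closed `refuted`) or through the UNIFORM
strengthening the simulation argument really consumes — a P-uniform scheme of finite Gaussian
descriptions (ℚ[i] coefficients; DiasKoenig2024 Desc_n = rational antisymmetric generator /
covariance matrix + reference string + amplitude, or matchgate/Givens words with
Pythagorean-rational angles) with normSq error ≤ 1/(k+1)² — which is NOT typed yet (no finite
Gaussian-description vocabulary; stabilizer pattern: Dequantize DeqStabrankPolyUniform / 0244). Its
printed NON-uniform half is crux GaussRankPolyImpliesPPoly (`GaussRankPolyThesis → BQP ⊆ P/poly`:
JozsaMiyake2008 pair encoding with CZ = G(Z,X)·SWAP, HebenstreitEtAl2019 SWAP gadget consuming one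
|M⟩, DiasKoenig2024 Table 3 χ-simulators with phase-sensitive Gaussian overlaps, Adleman).

## What this route is for (planner's honest bet)
X is very probably FALSE and the route is EXPECTED to die by its own rank-2 crux:
NegApproxGaussRankSuperpoly (∃ δ < 1 with χ^G_δ(M^{⊗t}) superpolynomial) refutes
GaussRankPolyThesis, the route goes BROKEN → closed `refuted`, and the negatives index records
"polynomial approximate Gaussian rank of matchgate-magic powers: REFUTED" — the fermionic-rank
dequantizer family (CudbyStrelchuk2023 §6, DiasKoenig2024, ReardonsmithOszmaniecKorzekwa2024,
arXiv:2603.18869) retired by a THEOREM rather than a belief. What makes this more than a mirror of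
route Dequantize is the MECHANISM available only on this island: Gaussian states form an algebraic
variety (the spinor variety; "rank ≤ r" = membership in its r-th secant), so
Strassen/Landsberg–Ottaviani FLATTENINGS apply. The Clifford-multiplication flattening F_K(ψ): e_S ↦
c_S ψ (|S| = K Majoranas) has rank ≤ D_K(N) = Σ_{j≤K, j≡K (2)} C(N,j) on every Gaussian state
(isotropy of the annihilator space ⇒ normal-ordering deficiency) but ≥ C(t,K)·8^K on |M⟩^{⊗t} (the
covariance matrix of GHZ_4 VANISHES, so the 8 vectors c_a|M⟩ are orthonormal), giving χ^G(M^{⊗t}) ≥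
max_K C(t,K)8^K / D_K(4t) ≈ 1.259^t for EXACT and BORDER rank and for every δ ≤ C(8t,K)^{-1/2} (crux
FlatteningBoundRobust, support FlatteningBoundExact — provable NOW; CudbyStrelchuk2023 could certify
only the 2-copy symmetric case and wrote that lower bounds "will require new techniques"). The open
step is constant δ (crux NegApproxGaussRankSuperpoly): the certified singular values are flat, so a
quantitative rigidity statement for points near the secant variety is needed. Crux
GaussRankTwoCopies (χ^G(M⊗M) = 4, the Cudby–Strelchuk conjecture; flattening gives 3) calibrates
tightness.

Rationale: WHY THIS LINE. Literature BQP is Clifford+T; compiled into the pair encoding it is nearest-neighbour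
matchgates (free fermions, classically simulable: Valiant/Terhal–DiVincenzo/JozsaMiyake2008) plus
one SWAP per CNOT, and each SWAP is a Gaussian gadget consuming one copy of the 4-qubit magic state
|M⟩ (HebenstreitEtAl2019). Exactly as stabilizer rank governs Clifford+T simulation (route
Dequantize), the (approximate) fermionic Gaussian RANK of |M⟩^{⊗t} governs the cost of the FLO-rank
simulators now in print (DiasKoenig2024 Tables 3–4, ReardonsmithOszmaniecKorzekwa2024,
CudbyStrelchuk2023 §6): X = "that rank is polynomial" gives BQP ⊆ P/poly (crux 4) and, with uniform
decompositions, BQP ⊆ BPP = ¬QuantumAdvantage (Assembly). Imported area: algebraic geometry of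
secant varieties (LandsbergOttaviani2011 flattenings; Manivel2009 spinor varieties;
Chevalley/Bravyi2005 pure spinors ↔ maximal isotropic annihilators). Unlike the stabilizer island,
the free dictionary here is a Lie-group orbit = an algebraic variety with ANNIHILATORS, so the
oldest rank-lower-bound device (flattening rank is subadditive and Zariski-closed) bites: it already
kills X for exact, border and 2^{-εt}-precise rank (crux 3), which no additive-combinatorics method
achieves for |T⟩^{⊗t} (best Ω̃(t²), MehrabanTahmasbi2024). The route exists (i) to land that
theorem, (ii) to stage the genuinely open constant-δ kill (crux 2), (iii) to give the matchgate
dequantizer family a typed, refutable object (target + crux 4), and (iv) to calibrate flattening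
tightness on the Cudby–Strelchuk conjecture (crux 5). Catalogue used: algebraic/geometric lift
(secant varieties) + certified computation (crux 5); no physical analogy beyond the standard JW
dictionary (qubit line ↔ 2n Majoranas, matchgate ↔ Spin(2n) rotation, Gaussian state ↔ pure spinor).
RANKED CRUXES. r2 NegApproxGaussRankSuperpoly (KILL: ∃ δ∈(0,1) superpolynomial δ-approximate
Gaussian rank of M^{⊗t}; hardest, most informative; refutes the target). r3 FlatteningBoundRobust
(r·D_K(4t) < C(t,K)8^K ⇒ every r-term Gaussian combination is at distance² ≥ 1/C(8t,K) from M^{⊗t}: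
exponential exact/border/robust rank; provable now, new). r4 GaussRankPolyImpliesPPoly (X ⇒ BQP ⊆
P/poly; in print modulo assembly: pair encoding, gadget, χ-simulator, Adleman). r5
GaussRankTwoCopies (χ^G(M⊗M) = 4; CudbyStrelchuk2023 §6.2 conjecture; flattening gives 3). Support:
FlatteningBoundExact (δ = 0 algebraic core of r3), GaussRankPolyCollapse (X → BQP ⊆ BPP, the
collapse antecedent of the deciding theorem `closes`). Target GaussRankPolyThesis (X); Assembly
(same wiring as `closes`, antecedent inline).
KILL CRITERIA. r2 proved ⇒ target refuted ⇒ route closes `refuted` with census "FLO-rank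
dequantizers retired" (intended). r3 REFUTED (a ≤ r-term Gaussian decomposition violating the
flattening count) ⇒ the mechanism is wrong: close the route at once and retire the card. r5 refuted
(rank 3) ⇒ flattenings are tight at t = 2 but the secant geometry is subtler than expected:
informative, not fatal. X PROVED (with uniformity) ⇒ ¬QuantumAdvantage — the formal target; nobody
expects it.
NOT DECOMPOSED YET. The UNIFORM collapse (P-uniform encodings of approximate Gaussian
decompositions: covariance matrices / Givens angles to poly bits) — only its non-uniform-hypothesis
core GaussRankPolyCollapse (X → BQP ⊆ BPP, support 10445, antecedent of `closes`) is typed; the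
uniform scheme needs a finite Gaussian-description vocabulary (tenure follow-up, Dequantize
DeqStabrankPolyUniform pattern). The definition file
Literature/Computability/QuantumComplexity/GaussianRank.lean (majorana + CAR, IsGaussian,
gaussianRank, approxGaussianRank, magicM, magicMPow, flatteningDeficiency) has LANDED; the items'
inline lets are Iff.rfl-identical to it (route-review pass 5, evidence W_qa2.lean on 1244), so
provers may rewrite into the named API freely and a 1:1 restatement over named decls is a tenure
convenience, not a prerequisite. The card's B4 ("discrete flattening" for STABILIZER rank) is NOT
filed here: it is the mechanism of card every-certificate-of-magic-is-a-code and would be a separate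
route sharing Dequantize's kill item 0247. Rigidity lemmas for r2 and CAR-algebra infrastructure for
r3 ride as --supports lemmas, never items.
CHEAPEST FALSIFIER. Of the MECHANISM: a ≤ 2-term Gaussian decomposition of M⊗M (t = 2, K = 2:
flattening count 64/29 forces ≥ 3 terms) or any r-term decomposition of M^{⊗t} with r·D_K(4t) <
C(t,K)·8^K — a small exact computation refuting FlatteningBoundExact closes the route at once (kill
criteria). Of the TARGET X: none cheap — constant-δ rank lower bounds are the open crux r2; the t =
2 calibration (χ_G(M⊗M) = 3 or 4, crux r5) is the cheapest informative computation (3-term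
decomposition search, kit job j001422 filed by route review; a certified algebraic non-membership
certificate would settle it).
NOVELTY (short; full text in the Novelty field). Nearest prior: CudbyStrelchuk2023
(arXiv:2307.12654: Gaussian rank of M, 2-copy symmetric lower bound only, 'new techniques' needed);
DiasKoenig2024 / ReardonsmithOszmaniecKorzekwa2024 / arXiv:2603.18869 (simulators, upper bounds);
tool side LandsbergOttaviani2011, Manivel2009. Delta: flattening aimed at the spinor variety's
secants ⇒ first exponential (≈1.259^t) exact+border Gaussian-rank lower bound and an explicit
precision frontier; graded new-combination (NOVELTY-AUDIT-8). Searches 2026-08-15: lit search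
--source s2 (2023+, 20 rows, no rank lower bounds), lit galaxy search 'Gaussian rank' --star all (1
relevant), lit read of both key papers.
BARRIERS (short; full text in the Barriers field). Relativization/Algebrization: non-black-box
gate-by-gate simulation resp. statements about explicit tensors — outside both classes.
SeparationPrerequisites: a rank lower bound for explicit states is not a class separation; the route
is negative-side. PPolyOracles, NaturalProofs: not engaged. Negatives index: empty.
KNOWN LEDGER DEFECT (opener 2026-08-15; state after the glue repair 16:17Z): the informal-only note
stmt-QuantumAdvantage-1326 ('Assembly2', really the uniform-collapse SUPPORT note) is mis-kinded
`assembly` by the gate's legacy kind rule (the word 'Assembly' in its first 80 chars); the route's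
ONLY real assembly is stmt-QuantumAdvantage-1250 (decl Assembly) and the deciding theorem is
`closes`. Planner verbs cannot clear it: `--drop` ("the assembly item cannot be dropped"),
`--retriage` ("the assembly item cannot be retriaged") and `--restate` (post-edit D-0019
multi-assembly check) all bounce on 1326 — OPERATOR ACTION: re-kind 1326 to support or delete it
(its typable content now lives in GaussRankPolyCollapse, 10445); until then needs_repair keeps the
cosmetic `route.multi-assembly` entry while the route is open, staffable (0 unproved cone deps) and
its deciding theorem certified. `workitem add` and `--closes-file` edits DO work.

Novelty: Nearest prior art, searched 2026-08-15 (`lit search --source s2 "Gaussian rank fermionic magic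
states" --year-from 2023`: 20 rows — arXiv:2603.18869 Dias–Bosse–Seddon (optimal gate
decompositions, upper bounds), arXiv:2607.02242 (computable non-Gaussianity measures),
arXiv:2506.00116 (fermionic magic resources), arXiv:2604.26813 (simulation with magic input),
arXiv:2501.06179, arXiv:2604.27049: measures, simulators and UPPER bounds, no Gaussian-RANK lower
bound; `lit galaxy search "Gaussian rank" --star all`: 34 rows, 1 relevant = DiasKoenig2024; `lit
read arXiv:2307.12654` §6 (Def. 7, §6.1 numerics, §6.2 Conjecture χ_G(M⊗M) = 4, Prop. 6, p.13); `lit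
read doi:10.22331/q-2024-05-21-1350` §§1.3–1.6, 2.3–2.5, Tables 3–4; plus the card's and
NOVELTY-AUDIT-8's searches: arXiv 'fermionic Gaussian rank' 13 rows, crossref 2022+ 0/15, galaxy
intelligent (Lovitz NSF text = stabilizer rank only; Landsberg Trieste secant survey)). PROBLEM
side: CudbyStrelchuk2023 (Gaussian rank/extent of the matchgate magic state |M⟩; a lower bound only
for TWO copies under a Z₃Z₄-symmetry restriction; "further results on lower bounds for the Gaussian
rank will require new techniques"), DiasKoenig2024, ReardonsmithOszmaniecKorzekwa2024,
arXiv:2603.18869 (rank- /extent-based FLO simulators = the dequantizer family this route types and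
then kills). TOOL side: LandsbergOttaviani2011 (flattenings as equations for secant varieties),
Manivel2009 (secants of spinor varieties), Bravyi2005 (isotropic-subspace desc  [refs: 10.22331/q-2024-05-21-1350`, 2603.18869, 2607.02242, 2506.00116, 2604.26813, 2501.06179, 2604.27049, 2307.12654, doi:10.22331/q-2024-05-21-1350, DiasKoenig2024, CudbyStrelchuk2023, ReardonsmithOszmaniecKorzekwa2024, LandsbergOttaviani2011, Manivel2009, Bravyi2005]

Barriers (technique_class: simulation, dequantization, lower-bound, secant-flattening): technique_class: simulation, dequantization, lower-bound, secant-flattening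
- Literature.Barriers.QuantumAdvantage.Relativization: evaded in kind — the positive direction
(GaussRankPolyThesis ⇒ BQP ⊆ P/poly ⇒ with uniformity BQP ⊆ BPP) is a NON-black-box simulation
consuming the explicit Clifford+T gate list (pair-encoded matchgates + one |M⟩ gadget per CNOT) and
implies nothing about BQP^O (an oracle gate has no Gaussian-rank-bounded gadget), exactly as for
route Dequantize; the kill direction (flattening lower bounds) is a statement about explicit vectors
in (ℂ²)^{⊗4t}, outside the relativizing/diagonalization/simulation-of-machines class altogether.
- Literature.Barriers.QuantumAdvantage.Algebrization: same verdict — neither direction is an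
inclusion/separation argument of the shape C^A vs D^Ã nor arithmetization (AaronsonWigderson2008 Thm
5.11(v) constrains proofs of BQP ⊆ BPP; a Gaussian-rank simulation is gate-by-gate and
non-algebrizing in kind).
- Literature.Barriers.QuantumAdvantage.SeparationPrerequisites: not engaged — "lower-bound" here is
a RANK lower bound for explicit states (non-membership in a secant variety), not a class separation;
NegApproxGaussRankSuperpoly / FlatteningBoundRobust imply nothing about P vs PP or PSPACE and do not
prove QuantumAdvantage (negative-side route; expected close `refuted`, recorded as negative
knowledge).
- Literature.Barriers.QuantumAdvantage.PPolyOracles: not engaged — no oracle, efficiently computable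
or otherwise, appears; cr

History (route lifecycle, newest last):
- 2026-08-16T04:14:46Z · BROKEN — GaussRankPolyThesis (stmt-QuantumAdvantage-1244, target) refuted by Summit.QuantumAdvantage.QuantumAdvantage.Theorems.SpinorFlatteningGaussRankPolyThesis_refuted @ 1fc1f4666c4c (refuter-cdisprove-stmt-QuantumAdvantage-1247-g2-0)
- 2026-08-16T04:23:28Z · CLOSED refuted — refuted:stmt-QuantumAdvantage-1244 (GaussRankPolyThesis) by Summit.QuantumAdvantage.QuantumAdvantage.Theorems.SpinorFlatteningGaussRankPolyThesis_refuted (planner-rfix-QuantumAdvantage-SpinorFlatteni-1f11c3df-0)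

sub-problem: QuantumAdvantage · status: closed(refuted) · opened planner-plancard-QuantumAdvantage-QuantumAdva-86934e09-0 2026-08-15T10:53:57Z · rev 5 · ledger route-QuantumAdvantage-SpinorFlattening
GENERATED by the gate from the ledger (D-0016/17). Provers cite these decls: `theorem foo : Summit.QuantumAdvantage.QuantumAdvantage.Theses.SpinorFlattening.<Decl> := …` in Summits/QuantumAdvantage/QuantumAdvantage/Theorems/<Name>.lean.
-/

namespace Summit.QuantumAdvantage.QuantumAdvantage.Theses.SpinorFlattening

open scoped BigOperators Topology Manifold Classical MeasureTheory ProbabilityTheory Matrix InnerProductSpace ComplexConjugate ContinuousMap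
open Filter Set Function TopologicalSpace MeasureTheory

attribute [summit_statement] _root_.QuantumAdvantage

open Literature.QuantumAdvantage

/-- item stmt-QuantumAdvantage-1244 · crux (kind.auto-crux: conjecture-grade) · rank 0 · closed · refuted by Summit.QuantumAdvantage.QuantumAdvantage.Theorems.SpinorFlatteningGaussRankPolyThesis_refuted @ 1fc1f4666c4c (refuter) · by planner
why it might fail: Probably FALSE: FlatteningBoundRobust refutes it for exact/border rank and δ ≤ C(8t,K)^{-1/2} (rank ≈ 1.259^t); Gaussian fidelity of M^{⊗t} is 2^{-t}; only the constant-δ regime is open (crux NegApproxGaussRankSuperpoly).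
sources: CudbyStrelchuk2023 §6 Def. 7, §6.1-6.2 (arXiv:2307.12654), DiasKoenig2024 §1.3, §2.3, Tables 3-4 (doi:10.22331/q-2024-05-21-1350), HebenstreitEtAl2019 (SWAP gadget, magic state), Bravyi2005 (isotropic-subspace description of Gaussian states), ReardonsmithOszmaniecKorzekwa2024
[target] Thesis X of route SpinorFlattening (targets ¬QuantumAdvantage, i.e. BQP ⊆ BPP, by
fermionic-linear-optics + magic-state RANK simulation): for every δ > 0 there is c such that for all
t some linear combination of ≤ t^c + c Gaussian states is δ-close (normSq ≤ δ²) to |M>^{⊗t} —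
polynomial δ-approximate fermionic Gaussian rank of matchgate-magic powers. Inline vocabulary
(shared verbatim by every item of this route until the requested definition file GaussianRank.lean
lands, then restated 1:1 over named decls): maj n j b = Jordan-Wigner Majorana operator Z^{<j}X_j (b
= false) / Z^{<j}Y_j (b = true) on QReg n, written with the tree's pauliString
(PauliExpansion.lean); IsGauss n psi := psi ≠ 0 and psi is annihilated by n linearly independent
linear combinations of the 2n Majoranas (pure spinor = Fock vacuum of some quasi-particle basis:
Chevalley; Bravyi2005 isotropic-subspace description) = the dictionary G_n of all pure fermionic
Gaussian states of BOTH parities (DiasKoenig2024 §2.3 = O(2n)-orbit of the vacuum;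
CudbyStrelchuk2023 = matchgate circuits applied to basis states); Mpow t = |M>^{⊗t} on t*4 qubits in
closed form, |M> = (|0000>+|1111>)/sqrt 2 the canonical matchgate -/
@[route_item "route-QuantumAdvantage-SpinorFlattening"]
def GaussRankPolyThesis : Prop :=
  let maj : (n : ℕ) → Fin n → Bool → Matrix (Literature.Computability.Cryptography.QReg n) (Literature.Computability.Cryptography.QReg n) ℂ := fun n j b => Literature.Computability.QuantumComplexity.pauliString (fun i : Fin n => if i < j then Literature.Computability.QuantumComplexity.Pauli.Z else if i = j then (if b then Literature.Computability.QuantumComplexity.Pauli.Y else Literature.Computability.QuantumComplexity.Pauli.X) else Literature.Computability.QuantumComplexity.Pauli.I); let IsGauss : (n : ℕ) → (Literature.Computability.Cryptography.QReg n → ℂ) → Prop := fun n ψ => ψ ≠ 0 ∧ ∃ A : Fin n → (Fin n × Bool → ℂ), LinearIndependent ℂ A ∧ ∀ k, Matrix.mulVec (∑ p : Fin n × Bool, A k p • maj n p.1 p.2) ψ = 0; let Mpow : (t : ℕ) → (Literature.Computability.Cryptography.QReg (t * 4) → ℂ) := fun t x => if (∀ k : Fin t, ∀ i : Fin 4, x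 (finProdFinEquiv (k, i)) = x (finProdFinEquiv (k, (0 : Fin 4)))) then ((Real.sqrt 2 : ℂ)⁻¹) ^ t else 0; ∀ δ : ℝ, 0 < δ → ∃ c : ℕ, ∀ t : ℕ, ∃ r : ℕ, r ≤ t ^ c + c ∧ ∃ (a : Fin r → ℂ) (g : Fin r → Literature.Computability.Cryptography.QReg (t * 4) → ℂ), (∀ i, IsGauss (t * 4) (g i)) ∧ Literature.Computability.Cryptography.normSq (Mpow t - ∑ i, a i • g i) ≤ δ ^ 2

/-- item stmt-QuantumAdvantage-1245 · crux · rank 2 · closed · proved by Summit.QuantumAdvantage.QuantumAdvantage.Theorems.SpinorFlattening.NegApproxGaussRankSuperpoly_of (prover) · by planner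
why it might fail: Constant-δ poly Gaussian rank is excluded by nothing in print; the flattening's certified singular values are flat (all 1), so a 2^{-o(t)} perturbation may collapse them; fidelity→rank needs coefficient control that fails for ill-conditioned frames of a continuum dictionary.
sources: CudbyStrelchuk2023 §6.1-6.2, p.13 'new techniques' (arXiv:2307.12654), DiasKoenig2024 §5 (multiplicativity for 4-mode factors), §1.6, MehrabanTahmasbi2024 Thm 1.1 (stabilizer twin: Omega~(t^2)), arXiv:2503.04101 Thm 31 (bounded-coefficient lemma, stabilizer side), tree item stmt-QuantumAdvantage-0247 (Dequantize.DeqNegStabrankSuperpoly, the stabilizer twin)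
[crux] KILL ITEM (S-side flavour; matchgate twin of Dequantize's DeqNegStabrankSuperpoly =
stmt-QuantumAdvantage-0247): there is a CONSTANT δ in (0,1) such that for every c some t has every
linear combination of ≤ t^c + c Gaussian states at normSq-distance > δ² from |M>^{⊗t} —
superpolynomial constant-precision approximate Gaussian rank. Proving it refutes the target
GaussRankPolyThesis (route → BROKEN → closed refuted: the intended, informative outcome). Line of
attack: the Clifford-multiplication flattening F_K of FlatteningBoundRobust certifies rank ≥
C(t,K)8^K/D_K(4t) ≈ 2^{0.3326 t} (K = 4t/7) but only tolerates δ ≤ C(8t,K)^{-1/2} because all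
certified singular values equal 1 (Weyl); constant δ needs either (a) a quantitative rigidity /
Lojasiewicz-type inequality for the flattening minors near M^{⊗t} (how fast can σ_R of F_K drop
along a δ-perturbation that lands on the r-th secant of the spinor variety?), or (b)
multiplicativity of the Gaussian fidelity F(M^{⊗t}) = 2^{-t} (CudbyStrelchuk2023; DiasKoenig2024 §5,
4-mode factors) turned into a RANK bound through a bounded-coefficient lemma for near-optimal
Gaussian frames (stabilizer-side analogues: Kalra-Sinha arXiv:2503.04101 -/
@[route_item "route-QuantumAdvantage-SpinorFlattening"]
def NegApproxGaussRankSuperpoly : Prop :=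
  let maj : (n : ℕ) → Fin n → Bool → Matrix (Literature.Computability.Cryptography.QReg n) (Literature.Computability.Cryptography.QReg n) ℂ := fun n j b => Literature.Computability.QuantumComplexity.pauliString (fun i : Fin n => if i < j then Literature.Computability.QuantumComplexity.Pauli.Z else if i = j then (if b then Literature.Computability.QuantumComplexity.Pauli.Y else Literature.Computability.QuantumComplexity.Pauli.X) else Literature.Computability.QuantumComplexity.Pauli.I); let IsGauss : (n : ℕ) → (Literature.Computability.Cryptography.QReg n → ℂ) → Prop := fun n ψ => ψ ≠ 0 ∧ ∃ A : Fin n → (Fin n × Bool → ℂ), LinearIndependent ℂ A ∧ ∀ k, Matrix.mulVec (∑ p : Fin n × Bool, A k p • maj n p.1 p.2) ψ = 0; let Mpow : (t : ℕ) → (Literature.Computability.Cryptography.QReg (t * 4) → ℂ) := fun t x => if (∀ k : Fin t, ∀ i : Fin 4, x (finProdFinEquiv (k, i)) = x (finProdFinEquiv (k, (0 : Fin 4)))) then ((Real.sqrt 2 : ℂ)⁻¹) ^ t else 0; ∃ δ : ℝ, 0 < δ ∧ δ < 1 ∧ ∀ c : ℕ, ∃ t : ℕ, ∀ r : ℕ,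 r ≤ t ^ c + c → ∀ (a : Fin r → ℂ) (g : Fin r → Literature.Computability.Cryptography.QReg (t * 4) → ℂ), (∀ i, IsGauss (t * 4) (g i)) → δ ^ 2 < Literature.Computability.Cryptography.normSq (Mpow t - ∑ i, a i • g i)

/-- item stmt-QuantumAdvantage-1246 · crux · rank 3 · closed · moot by None · by planner
why it might fail: New, unrefereed (hand-checked once): deficiency D_K must cover both parities and mixed sums (it does by linearity), fullness needs JW signs across blocks and <M|c_ac_b|M> = δ_ab exactly, (iii) needs c_S unitary + e_S orthonormal; risk = bookkeeping, weight = formalisation.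
sources: idea card Summits/QuantumAdvantage/QuantumAdvantage/Ideas/spinor-flattening-gaussian-rank.md (B1) + NOVELTY-AUDIT-8 correctness check, LandsbergOttaviani2011 (flattenings / equations for secant varieties), Manivel2009 (spinor varieties and their secants, doi:10.3842/SIGMA.2009.078), Bravyi2005 (Gaussian states ↔ isotropic subspaces), CudbyStrelchuk2023 §6.2 Prop. 6, p.13, DiasKoenig2024 §2.4-2.5 (covariance matrix, Wick)
[crux] THE FLATTENING BOUND, robust form (idea card spinor-flattening-gaussian-rank, B1): for all t
K r with r·D_K(4t) < C(t,K)·8^K, where D_K(N) = Σ_{j ≤ K, j ≡ K mod 2} C(N,j), every linear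
combination φ of r Gaussian states on 4t qubits satisfies 1 ≤ C(8t,K)·‖M^{⊗t} − φ‖². Consequences:
exact AND border Gaussian rank of M^{⊗t} ≥ max_K ⌈C(t,K)8^K / D_K(4t)⌉ (t=1: 2 = truth; t=2, K=2:
64/29 ⇒ ≥ 3; asymptotically 2^{f(4/7)t − O(log t)}, f(α) = H(α)+3α−4H(α/4), f(4/7) ≈ 0.3326, i.e. ≈
1.259^t) and δ-approximate rank ≥ 2^{c(ε)t} whenever δ ≤ 2^{-εt}. Proof sketch (hand-checked by
refuter-novelty-audit-QuantumAdvantage-QuantumAdvantage-8-0): F_K(ψ): Λ^K C^{8t} → (C²)^{⊗4t}, e_S ↦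
c_S ψ (ordered product of the K Majoranas in S). (i) DEFICIENCY: a Gaussian g has an isotropic
annihilator space L of dimension 4t; pick an isotropic complement L'; normal ordering (each l ∈ L
moved right either dies on g or contracts with one factor, dropping the degree by 2) puts c_S g in
span{w_1⋯w_j g : w_i ∈ L', j ≤ K, j ≡ K (2)}, of dimension ≤ D_K(4t) (products of elements of an
isotropic space are alternating); hence rank F_K(Σ_{i<r} a_i g_i) ≤ r·D_K(4t) by linearity. (ii)
FULLNESS: Z^{⊗4}|M> = |M> an -/
@[route_item "route-QuantumAdvantage-SpinorFlattening", crux]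
def FlatteningBoundRobust : Prop :=
  let maj : (n : ℕ) → Fin n → Bool → Matrix (Literature.Computability.Cryptography.QReg n) (Literature.Computability.Cryptography.QReg n) ℂ := fun n j b => Literature.Computability.QuantumComplexity.pauliString (fun i : Fin n => if i < j then Literature.Computability.QuantumComplexity.Pauli.Z else if i = j then (if b then Literature.Computability.QuantumComplexity.Pauli.Y else Literature.Computability.QuantumComplexity.Pauli.X) else Literature.Computability.QuantumComplexity.Pauli.I); let IsGauss : (n : ℕ) → (Literature.Computability.Cryptography.QReg n → ℂ) → Prop := fun n ψ => ψ ≠ 0 ∧ ∃ A : Fin n → (Fin n × Bool → ℂ), LinearIndependent ℂ A ∧ ∀ k, Matrix.mulVec (∑ p : Fin n × Bool, A k p • maj n p.1 p.2) ψ = 0; let Mpow : (t : ℕ) → (Literature.Computability.Cryptography.QReg (t * 4) → ℂ) := fun t x => if (∀ k : Fin t, ∀ i : Fin 4, x (finProdFinEquiv (k, i)) = x (finProdFinEquiv (k, (0 : Fin 4)))) then ((Real.sqrt 2 : ℂ)⁻¹) ^ t else 0; ∀ t K r : ℕ, r * (∑ j ∈ (Finset.range (K + 1)).filter (fun j =>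 j % 2 = K % 2), (t * 4).choose j) < t.choose K * 8 ^ K → ∀ (a : Fin r → ℂ) (g : Fin r → Literature.Computability.Cryptography.QReg (t * 4) → ℂ), (∀ i, IsGauss (t * 4) (g i)) → (1 : ℝ) ≤ ((t * 8).choose K : ℝ) * Literature.Computability.Cryptography.normSq (Mpow t - ∑ i, a i • g i)

/-- item stmt-QuantumAdvantage-1247 · crux · rank 4 · closed · moot by None · by planner
why it might fail: No verbatim statement in print for the Clifford+T ⊆ P/poly packaging: exact pair-encoding compilation, M-equivalence of the gadget state, rounding Gaussian descriptions inside the δ budget and adaptivity with superposed inputs must all be assembled; heavy.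
sources: DiasKoenig2024 §1.5 Table 3, §3 Lemma 3.2-Thm 3.3, §4 Thm 4.1 (doi:10.22331/q-2024-05-21-1350), HebenstreitEtAl2019 (doi:10.1103/PhysRevLett.123.080503: SWAP gadget from one magic state), JozsaMiyake2008 §5 (pair encoding; matchgates + SWAP universal; doi:10.1098/rspa.2008.0189), CudbyStrelchuk2023 §6 p.12 (M is matchgate-equivalent to the gadget state), ReardonsmithOszmaniecKorzekwa2024 (FLO-rank/extent simulator), MehrabanTahmasbi2024 Thm 1.10 (stabilizer twin; Adleman packaging)
[crux] GaussRankPolyThesis → BQP ⊆ P/poly: the printed, NON-uniform half of the Assembly's collapse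
antecedent (matchgate twin of Dequantize's DeqStabrankPolyImpliesBQPSubsetPPoly =
stmt-QuantumAdvantage-0470). Proof in print modulo assembly: (1) compile the n-th Clifford+T circuit
EXACTLY into nearest-neighbour matchgates + SWAP on 2·width qubits via the pair encoding |0_L> =
|00>, |1_L> = |11> (JozsaMiyake2008 §5): every single-qubit U (H, S, T) is the matchgate G(U,U);
logical qubits are reordered for free by fSWAP = G(Z,X) networks (even-parity pairs pick up no
sign); CZ on physical neighbours = G(Z,X)·SWAP, so #SWAP = #CNOT ≤ size(n); (2) replace each SWAP by
the HebenstreitEtAl2019 gadget — adaptive matchgates + occupation-number measurements consuming one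
4-qubit magic state matchgate-equivalent to |M> (CudbyStrelchuk2023 §6, p.12); (3) the whole run is
ONE quantum instrument on |x_enc> ⊗ |M>^{⊗k(n)}, k ≤ poly(n): replacing |M>^{⊗k} by φ/‖φ‖ with
‖M^{⊗k} − φ‖ ≤ δ moves the acceptance probability by ≤ 4δ, so δ = 1/40 keeps a constant gap; (4) φ =
Σ_{i ≤ χ} a_i g_i with χ ≤ k^c + c by hypothesis; |x_enc> ⊗ g_i is Gaussian, so the input has
Gaussian rank ≤ χ and the χ-simulator -/
@[route_item "route-QuantumAdvantage-SpinorFlattening"]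
def GaussRankPolyImpliesPPoly : Prop :=
  GaussRankPolyThesis → Literature.Computability.Cryptography.BQP ⊆ Literature.Computability.Complexity.PPoly

/-- item stmt-QuantumAdvantage-1248 · crux · rank 5 · closed · moot by None · by planner
why it might fail: The rank may genuinely be 3: annealing in a 256-dim space with a 29-parameter continuous dictionary per term is weak evidence, the symmetric-case proof (Prop. 6) does not transfer, and the flattening F_2 stops at 3.
sources: CudbyStrelchuk2023 §6.2 Conjecture chi_G(M⊗M) = 4, Prop. 6, App. 11 (arXiv:2307.12654), Manivel2009 (secants of spinor varieties), DiasKoenig2024 §5 (4-mode factors, Gaussian fidelity 1/2 of |a_8> = M)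
[crux] χ_G(M ⊗ M) ≥ 4 (hence = 4, since χ_G(M) = 2): two copies of the matchgate magic state on 8
qubits are not a linear combination of three Gaussian states. This is the CONJECTURE of
CudbyStrelchuk2023 §6.2 (proved there only for Z_3Z_4-symmetry-restricted decompositions, Prop. 6 /
App. 11, with hundreds of CPU-hours of failed simulated annealing as evidence, §6.1);
FlatteningBoundExact certifies only ≥ 3 (K = 2: 64/29). Smallest case calibrating whether
flattenings are tight on the spinor island. Natural tools: a finer flattening using two Majoranas
per block (the full 1+8+7 profile of the block Clifford module on GHZ_4), the geometry of the 8-mode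
even/odd spinor varieties and their third secant (Manivel2009), or a certified computer-algebra
refutation (exact Nullstellensatz / Groebner certificate that M⊗M ∉ σ_3; kit compute, then a
Lean-checkable certificate). Inline vocabulary (shared verbatim by every item of this route until
the requested definition file GaussianRank.lean lands, then restated 1:1 over named decls): maj n j
b = Jordan-Wigner Majorana operator Z^{<j}X_j (b = false) / Z^{<j}Y_j (b = true) on QReg n, written
with the tree's pauliString (PauliExpansion.lean); I -/
@[route_item "route-QuantumAdvantage-SpinorFlattening"]
def GaussRankTwoCopies : Prop :=
  let maj : (n : ℕ) → Fin n → Bool → Matrix (Literature.Computability.Cryptography.QReg n) (Literature.Computability.Cryptography.QReg n) ℂ := fun n j b => Literature.Computability.QuantumComplexity.pauliString (fun i : Fin n => if i < j then Literature.Computability.QuantumComplexity.Pauli.Z else if i = j then (if b then Literature.Computability.QuantumComplexity.Pauli.Y else Literature.Computability.QuantumComplexity.Pauli.X) else Literature.Computability.QuantumComplexity.Pauli.I); let IsGauss : (n : ℕ) → (Literature.Computability.Cryptography.QReg n → ℂ) → Prop := fun n ψ => ψ ≠ 0 ∧ ∃ A : Fin n → (Fin n × Bool → ℂ), LinearIndependent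 ℂ A ∧ ∀ k, Matrix.mulVec (∑ p : Fin n × Bool, A k p • maj n p.1 p.2) ψ = 0; let Mpow : (t : ℕ) → (Literature.Computability.Cryptography.QReg (t * 4) → ℂ) := fun t x => if (∀ k : Fin t, ∀ i : Fin 4, x (finProdFinEquiv (k, i)) = x (finProdFinEquiv (k, (0 : Fin 4)))) then ((Real.sqrt 2 : ℂ)⁻¹) ^ t else 0; ∀ (a : Fin 3 → ℂ) (g : Fin 3 → Literature.Computability.Cryptography.QReg (2 * 4) → ℂ), (∀ i, IsGauss (2 * 4) (g i)) → Mpow 2 ≠ ∑ i, a i • g i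

/-- item stmt-QuantumAdvantage-10445 · support · rank 9 · closed · moot by None · by planner
[support] COLLAPSE ANTECEDENT of the deciding theorem (typed core of the former informal note
stmt-QuantumAdvantage-1326; matchgate twin of Dequantize 0244): polynomial δ-approximate fermionic
Gaussian rank of the matchgate-magic powers |M⟩^{⊗t} (= GaussRankPolyThesis) implies BQP ⊆ BPP; with
the target it yields the deciding theorem `closes : GaussRankPolyCollapse → GaussRankPolyThesis → ¬
QuantumAdvantage`. HONEST STATUS: as typed (non-uniform existence hypothesis ⇒ uniform conclusion)
it is provable only (i) ex falso once the kill item NegApproxGaussRankSuperpoly (⇒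
¬GaussRankPolyThesis) lands — the expected outcome, after which the route closes `refuted` — or (ii)
through the UNIFORM strengthening of the hypothesis that the simulation argument really consumes: a
P-uniform scheme listing, on input (1^t, 1^k), ≤ poly(t,k) pairs (coefficient in ℚ[i]; finite
description of a Gaussian state on 4t qubits — rational antisymmetric generator / covariance matrix
with reference string and amplitude = DiasKoenig2024 Desc_n, or a matchgate/Givens word with
Pythagorean-rational angles) with normSq error ≤ 1/(k+1)²; given that, BQP ⊆ BPP is in print modulo
packaging: JozsaMiyake2008 §5 pair e -/
@[route_item "route-QuantumAdvantage-SpinorFlattening"]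
def GaussRankPolyCollapse : Prop :=
  GaussRankPolyThesis → Literature.Computability.Cryptography.BQP ⊆ Literature.Computability.Complexity.BPP

/-- item stmt-QuantumAdvantage-1249 · support · rank 9 · closed · proved by Summit.QuantumAdvantage.QuantumAdvantage.Theorems.SpinorFlattening.FlatteningBoundExact_proof @ 7c454e81b185 (prover) · by planner
sources: idea card spinor-flattening-gaussian-rank (B1), LandsbergOttaviani2011, Manivel2009, Bravyi2005, CudbyStrelchuk2023 §6
[support] δ = 0 core of crux FlatteningBoundRobust, filed separately so the purely algebraic half
(CAR algebra of Jordan-Wigner strings, normal-ordering deficiency D_K(N) = Σ_{j ≤ K, j ≡ K (2)}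
C(N,j) for Gaussian states, orthonormality of the one-Majorana-per-block images of M^{⊗t}, rank
subadditivity) can land first with no singular values: r·D_K(4t) < C(t,K)·8^K ⇒ M^{⊗t} is not a
linear combination of r Gaussian states. Yields exact Gaussian rank χ_G(M^{⊗t}) ≥ max_K
⌈C(t,K)8^K/D_K(4t)⌉ ≥ 2^{0.3326 t − O(log t)} ≈ 1.259^t (CudbyStrelchuk2023 trivial upper bound 2^t;
their only lower bound: 4 for two symmetric copies). Sources: idea card
spinor-flattening-gaussian-rank; LandsbergOttaviani2011 (flattenings), Manivel2009, Bravyi2005.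
Inline vocabulary (shared verbatim by every item of this route until the requested definition file
GaussianRank.lean lands, then restated 1:1 over named decls): maj n j b = Jordan-Wigner Majorana
operator Z^{<j}X_j (b = false) / Z^{<j}Y_j (b = true) on QReg n, written with the tree's pauliString
(PauliExpansion.lean); IsGauss n psi := psi ≠ 0 and psi is annihilated by n linearly independent
linear combinations of the 2n Majoranas (pure spinor = Fock vac -/
@[route_item "route-QuantumAdvantage-SpinorFlattening"]
def FlatteningBoundExact : Prop :=
  let maj : (n : ℕ) → Fin n → Bool → Matrix (Literature.Computability.Cryptography.QReg n) (Literature.Computability.Cryptography.QReg n) ℂ := fun n j b => Literature.Computability.QuantumComplexity.pauliString (fun i : Fin n => if i < j then Literature.Computability.QuantumComplexity.Pauli.Z else if i = j then (if b then Literature.Computability.QuantumComplexity.Pauli.Y else Literature.Computability.QuantumComplexity.Pauli.X) else Literature.Computability.QuantumComplexity.Pauli.I); let IsGauss : (n : ℕ) → (Literature.Computability.Cryptography.QReg n → ℂ) → Prop := fun n ψ => ψ ≠ 0 ∧ ∃ A : Fin n → (Fin n × Bool → ℂ), LinearIndependent ℂ A ∧ ∀ k, Matrix.mulVec (∑ p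 : Fin n × Bool, A k p • maj n p.1 p.2) ψ = 0; let Mpow : (t : ℕ) → (Literature.Computability.Cryptography.QReg (t * 4) → ℂ) := fun t x => if (∀ k : Fin t, ∀ i : Fin 4, x (finProdFinEquiv (k, i)) = x (finProdFinEquiv (k, (0 : Fin 4)))) then ((Real.sqrt 2 : ℂ)⁻¹) ^ t else 0; ∀ t K r : ℕ, r * (∑ j ∈ (Finset.range (K + 1)).filter (fun j => j % 2 = K % 2), (t * 4).choose j) < t.choose K * 8 ^ K → ∀ (a : Fin r → ℂ) (g : Fin r → Literature.Computability.Cryptography.QReg (t * 4) → ℂ), (∀ i, IsGauss (t * 4) (g i)) → Mpow t ≠ ∑ i, a i • g i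

/-- item stmt-QuantumAdvantage-1250 · assembly · rank 1 · closed · moot by None · by planner
sources: Summits/QuantumAdvantage/QuantumAdvantage/Statement.lean (QuantumAdvantage := ∃ L ∈ BQP, L ∉ BPP), planner Sketch.lean theorem assembly_holds
[assembly] (GaussRankPolyThesis → BQP ⊆ BPP) → GaussRankPolyThesis → ¬ QuantumAdvantage: unfold
QuantumAdvantage = ∃ L ∈ BQP, L ∉ BPP; two lines (proved in the planner's Sketch.lean). The first
antecedent is the UNIFORM collapse; its printed non-uniform half is crux GaussRankPolyImpliesPPoly,
the uniform encoding of Gaussian decompositions is deliberately deferred (cf. Dequantize 0244/0470). -/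
@[route_item "route-QuantumAdvantage-SpinorFlattening"]
def Assembly : Prop :=
  (GaussRankPolyThesis → Literature.Computability.Cryptography.BQP ⊆ Literature.Computability.Complexity.BPP) → GaussRankPolyThesis → ¬ QuantumAdvantage

-- item stmt-QuantumAdvantage-1326 · assembly · rank 9 · closed · moot by None · by planner — informal only, no Lean statement yet:
--   [support] (informal until an encoding exists — the Assembly's first antecedent `GaussRankPolyThesis
--   → BQP ⊆ BPP` in its honest, UNIFORM form; twin of Dequantize item stmt-QuantumAdvantage-0244.)
--   CLAIM: if there is a polynomial q such that for every δ ∈ (0,1) ∩ ℚ and every t a list of ≤ q(t,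
--   1/δ) pairs (a_i ∈ ℚ[i], d_i = a finite description of a fermionic Gaussian state on 4t qubits —
--   DiasKoenig2024 Desc_n = (covariance matrix Γ ∈ O(8t) antisymmetric, reference string x, reference
--   amplitude r), or a generating word of Givens rotations exp(θ/2 c_j c_k) with Pythagorean-rational
--   angles applied t

end Summit.QuantumAdvantage.QuantumAdvantage.Theses.SpinorFlattening
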